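import Summits.ResolutionOfSingularities.ResolutionOfSingularities.Theorems.HilbertSamuelEliminationSigmaMaxModificationsCorridor3SigmaMenuSurfacePointStep
import Summits.ResolutionOfSingularities.ResolutionOfSingularities.Theorems.HilbertSamuelEliminationSigmaMaxModificationsCorridor3SigmaCureMultisetLaw
import Literature.AlgebraicGeometry.Resolution.DivisorialPart
import HarnessLib

/-!
# [OURS · L1 W4.2] σ-LAYER PHASE B′ — `Corridor3SigmaSurfaceBadness`: THE BADNESS COUNT `M(E, D)` OF RECORD (the instance of o1's `SurfaceBadness`) —
# `M := Σ_c (2·S_c − 1 − k_c) + 2·X` over the codimension-one points `c` of the filtered trace configuration `S(E, D)` on the reduced surface `D̃`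
# (`S_c` = sum of the orders of the traces along `c`, `k_c` = number of traces through `c`, `X` = same-member crossings off the bad components), and its
# ZERO LOCUS: `M = 0` iff every component is carried ONCE with order ONE and no trace crosses itself
# (RULING v3.14-43 (KN) «(R-a) ADOPTED: M := multiplicity part + self-crossing count»; res-L1-w42-stub-1 DESIGN CHECKS 16:58Z / 17:45Z (a)(b); res-L1-type-o1
# 18:12:54Z `bad'`; crux chain w42 `SigmaMaxModifications` stmt-ResolutionOfSingularities-18506 / conjunct `SigmaMaxModificationsCorridor3`
# stmt-ResolutionOfSingularities-19249; helper of res-L1-w42-stub-1 (gen 6), `--supports stmt-…-19249 --as helper`, counted 0)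

HONEST FRAMING. OURS bookkeeping: DEFINITIONS and their elementary unfoldings over res-type-067's `Boundary.restrictOff` / `Boundary.divisorSet` / `membersThrough`,
Literature `idealOrder` (BGMW `ord`), `divisorialPoints` / `Order.coheight` (the tree's Cossart–Piltant divisorial dictionary, `…Resolution.DivisorialPart`), and
this seat's scheme-free kernel `CureLaw.μ` (p553245). `badOfRecord` replaces the role of «the invariant of the B′ cure phase» in the programme's own strategy;
NOTHING here is a statement of H. Hironaka's manuscript [Hironaka2017] nor of [CossartJannsenSaito2020]; no named fact. AI-written; AI review is weaker than expert
review.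

THE COUNT (design of record, RULING -43 (KN) + DESIGN CHECK 2). For a trace list `Γs` on a scheme `D` (instance: the filtered traces `E.restrictOff ι_D` on the
reduced surface `D̃`): at a CODIMENSION-ONE point `ζ` of the configuration `S = ⋃ supp Γ` (generic point of a component `c = cl{ζ}`), the MULTIPLICITY LIST
`compMults Γs ζ` = the orders `ord_ζ Γ ∈ ℕ` of the members through `ζ` (in boundary order); `S_c = Σ`, `k_c = #`; the component badness is
`μ = 2·S_c − 1 − k_c` (`CureLaw.μ`, `= 0` iff the list is `[1]`); `c` is BAD iff `S_c ≥ 2`. The CROSSING SET of a member `Γ` = the points lying on two distinct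
codimension-one components of `supp Γ` and on NO bad component of `S`; `X = Σ_Γ #crossings` (`Set.ncard`). `M := Σ_ζ μ_ζ + 2·X` (`finsum`; both sums are finite
on a Noetherian surface — `finite_setOf_mem_and_coheight_eq_one`, and `crossingPts_finite…` in the sequel — and the zero characterisation below is stated
under exactly these finiteness premises, so no junk value is ever consulted).

## Contents (namespace `…Theorems.SigmaMaxModificationsCorridor3.Sigma`)

* `Boundary.codimOnePoints`, `Boundary.compMults`, `Boundary.compBadness`, `Boundary.crossingPts`, `Boundary.crossingCount`,
  **`Boundary.badness`** (`M`), and the reading of record **`badOfRecord : SurfaceBadness`** (`M(E, D) := (E.restrictOff ι_D).badness`).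
* Unfoldings / zero locus: `codimOnePoints_eq`, `mem_crossingPts_iff`, `compMults_ne_nil`, `one_le_of_mem_compMults` (orders of non-zero stalks are finite and
  positive on the support), `compBadness_eq_zero_iff` (`↔ compMults = [1]`), `not_two_le_sum_of_compMults_eq`, **`badness_eq_zero_iff`** (finite index sets:
  `M = 0 ↔ (∀ ζ, μ_ζ = 0) ∧ (∀ Γ, crossings = ∅)`), `compMults_eq_singleton_one_iff` (`[1]` ↔ exactly one member through `ζ`, of order `1`), and the `M = 0`
  consequences `not_two_le_sum_of_badness_eq_zero`, `not_two_branches_of_badness_eq_zero`, `compMults_eq_singleton_of_badness_eq_zero`; the ℓ-GATED reading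
  **`badGatedOfRecord`** (`bad' := if ℓ = 0 then M else 0`, o1 18:12:54Z) with `badGatedOfRecord_eq_zero_iff` / `_pos_iff`.

VACUITY SELF-CHECK. Definitions; the witness of DESIGN CHECK 1 (one member with trace `V(xy)` on `D̃ ≅ 𝔸²`) has `compMults = [1]` at both generic points and ONE
crossing at the origin (on no bad component): `M = 2 > 0` — the cure (point step at the crossing) is due, as ruled. The drop laws at cure steps are NOT in this
file (owner: the cure sub-oracle's typer; kernel `CureLaw.μ_cureStep_lt`).
-/

noncomputable section

set_option linter.dupNamespace false -- mandated namespace of this single-conjunct summit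

open CategoryTheory AlgebraicGeometry TopologicalSpace IsLocalRing
open Summit.ResolutionOfSingularities.ResolutionOfSingularities.Theorems.CampaignW42
open Literature.AlgebraicGeometry.Resolution Literature.RingTheory.HilbertSamuel

namespace Summit.ResolutionOfSingularities.ResolutionOfSingularities.Theorems.SigmaMaxModificationsCorridor3.Sigma

universe u

open Scheme.IdealSheafData

/-! ## The count on a trace list -/

section Defs

variable {D : Scheme.{u}} (Γs : Boundary D)

/-- [OURS · L1 W4.2] **THE CODIMENSION-ONE POINTS OF THE CONFIGURATION** `S = ⋃_{Γ ∈ Γs} supp Γ`: its points of codimension one in `D` (generic points of the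
divisorial components; `= ⋃_Γ divisorialPoints Γ`). NOT a statement of the manuscript. [folklore] -/
def Boundary.codimOnePoints : Set D :=
  {ζ | ζ ∈ Γs.divisorSet ∧ Order.coheight ζ = 1}

/-- [OURS · L1 W4.2] **THE MULTIPLICITY LIST OF A COMPONENT**: the orders `ord_ζ Γ` (`idealOrder`, read in `ℕ`) of the members `Γ` through `ζ`, in boundary order.
NOT a statement of the manuscript. [folklore] -/
def Boundary.compMults (ζ : D) : List ℕ :=
  (membersThrough Γs ζ).map fun Γ => (idealOrder Γ ζ).toNat

/-- [OURS · L1 W4.2] **THE BADNESS OF A COMPONENT** `μ_ζ = 2·S_ζ − 1 − k_ζ` (`CureLaw.μ` of the multiplicity list: shared-ness plus non-reducedness).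
NOT a statement of the manuscript. [folklore] -/
def Boundary.compBadness (ζ : D) : ℕ :=
  CureLaw.μ (Γs.compMults ζ)

/-- [OURS · L1 W4.2] **THE CROSSING SET OF A MEMBER** `Γ`: the points on two distinct codimension-one components of `supp Γ` («`Γ` has two branches there») lying on
NO BAD component of the configuration — a component `cl{ζ}` is BAD iff its total multiplicity `S_ζ = Σ compMults ζ` is `≥ 2` (shared by two members, or carried
with order `≥ 2`); DESIGN CHECK 2 (b): crossings on a bad component are cured with the component and are not counted. NOT a statement of the manuscript.
[folklore] -/
def Boundary.crossingPts (Γ : D.IdealSheafData) : Set D :=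
  {x | (∃ ζ₁ ∈ divisorialPoints Γ, ∃ ζ₂ ∈ divisorialPoints Γ, ζ₁ ≠ ζ₂ ∧ ζ₁ ⤳ x ∧ ζ₂ ⤳ x) ∧
    ∀ ζ ∈ Γs.codimOnePoints, ζ ⤳ x → ¬ 2 ≤ (Γs.compMults ζ).sum}

/-- [OURS · L1 W4.2] **THE CROSSING COUNT** `X = Σ_Γ #(crossing set of Γ)` (`Set.ncard`; pairs (member, point)). NOT a statement of the manuscript. [folklore] -/
def Boundary.crossingCount : ℕ :=
  (Γs.map fun Γ => (Γs.crossingPts Γ).ncard).sum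

/-- [OURS · L1 W4.2] **THE BADNESS COUNT** `M := Σ_ζ μ_ζ + 2·X` over the codimension-one points `ζ` of the configuration (RULING v3.14-43 (KN) (R-a); DESIGN
CHECK 2: weight `2` on crossings). NOT a statement of the manuscript. [folklore] -/
def Boundary.badness : ℕ :=
  (∑ᶠ ζ ∈ Γs.codimOnePoints, Γs.compBadness ζ) + 2 * Γs.crossingCount

variable {Γs}

/-- Membership in the codimension-one points. [folklore] -/
theorem Boundary.mem_codimOnePoints_iff {ζ : D} : ζ ∈ Γs.codimOnePoints ↔ ζ ∈ Γs.divisorSet ∧ Order.coheight ζ = 1 :=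
  Iff.rfl

/-- **The codimension-one points of the configuration are the divisorial points of its members.** [folklore] -/
theorem Boundary.mem_codimOnePoints_iff_exists {ζ : D} : ζ ∈ Γs.codimOnePoints ↔ ∃ Γ ∈ Γs, ζ ∈ divisorialPoints Γ := by
  rw [Boundary.mem_codimOnePoints_iff, Boundary.mem_divisorSet_iff]
  constructor
  · rintro ⟨⟨Γ, hΓ, hζ⟩, h1⟩
    exact ⟨Γ, hΓ, hζ, h1⟩
  · rintro ⟨Γ, hΓ, hζ, h1⟩
    exact ⟨⟨Γ, hΓ, hζ⟩, h1⟩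

/-- A divisorial point of a member is a codimension-one point of the configuration. [folklore] -/
theorem Boundary.mem_codimOnePoints_of_mem_divisorialPoints {Γ : D.IdealSheafData} (hΓ : Γ ∈ Γs) {ζ : D} (hζ : ζ ∈ divisorialPoints Γ) :
    ζ ∈ Γs.codimOnePoints :=
  Boundary.mem_codimOnePoints_iff_exists.mpr ⟨Γ, hΓ, hζ⟩

/-- Membership in the crossing set. [folklore] -/
theorem Boundary.mem_crossingPts_iff {Γ : D.IdealSheafData} {x : D} :
    x ∈ Γs.crossingPts Γ ↔ (∃ ζ₁ ∈ divisorialPoints Γ, ∃ ζ₂ ∈ divisorialPoints Γ, ζ₁ ≠ ζ₂ ∧ ζ₁ ⤳ x ∧ ζ₂ ⤳ x) ∧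
      ∀ ζ ∈ Γs.codimOnePoints, ζ ⤳ x → ¬ 2 ≤ (Γs.compMults ζ).sum :=
  Iff.rfl

/-- Unfolding `compBadness`. [folklore] -/
theorem Boundary.compBadness_eq {ζ : D} : Γs.compBadness ζ = CureLaw.μ (Γs.compMults ζ) :=
  rfl

/-- Membership in the multiplicity list. [folklore] -/
theorem Boundary.mem_compMults_iff {ζ : D} {m : ℕ} : m ∈ Γs.compMults ζ ↔ ∃ Γ ∈ membersThrough Γs ζ, (idealOrder Γ ζ).toNat = m := by
  simp only [Boundary.compMults, List.mem_map]

/-- The multiplicity list has one entry per member through `ζ`. [folklore] -/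
theorem Boundary.length_compMults (ζ : D) : (Γs.compMults ζ).length = (membersThrough Γs ζ).length := by
  simp only [Boundary.compMults, List.length_map]

/-- **At a point of the configuration the multiplicity list is non-empty.** [folklore] -/
theorem Boundary.compMults_ne_nil {ζ : D} (hζ : ζ ∈ Γs.divisorSet) : Γs.compMults ζ ≠ [] := by
  intro h
  have h1 : membersThrough Γs ζ = [] := by
    have := Γs.length_compMults ζ
    rw [h, List.length_nil] at this
    exact List.length_eq_zero_iff.mp this.symm
  exact (Boundary.mem_divisorSet_iff_membersThrough_ne_nil.mp hζ) h1

/-- The order of a non-zero stalk in a Noetherian local ring is finite (Krull's intersection theorem). [folklore] -/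
theorem idealOrder_ne_top_of_stalkIdeal_ne_bot {I : D.IdealSheafData} {x : D} [IsNoetherianRing (D.presheaf.stalk x)] (h : stalkIdeal I x ≠ ⊥) :
    idealOrder I x ≠ ⊤ := by
  intro htop
  apply h
  have hall : ∀ n : ℕ, stalkIdeal I x ≤ maximalIdeal (D.presheaf.stalk x) ^ n := fun n =>
    (le_idealOrder_iff I x n).mp (by rw [htop]; exact le_top)
  have hle : stalkIdeal I x ≤ ⨅ n : ℕ, maximalIdeal (D.presheaf.stalk x) ^ n := le_iInf hall
  rw [Ideal.iInf_pow_eq_bot_of_isLocalRing _ (maximalIdeal.isMaximal _).ne_top] at hle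
  exact le_bot_iff.mp hle

/-- **The multiplicities are positive** when the members through `ζ` have non-zero stalks there (their orders are then finite, and `≥ 1` on the support).
[folklore] -/
theorem Boundary.one_le_of_mem_compMults {ζ : D} [IsNoetherianRing (D.presheaf.stalk ζ)] (hnz : ∀ Γ ∈ Γs, stalkIdeal Γ ζ ≠ ⊥) :
    ∀ m ∈ Γs.compMults ζ, 1 ≤ m := by
  intro m hm
  obtain ⟨Γ, hΓ, rfl⟩ := Boundary.mem_compMults_iff.mp hm
  obtain ⟨hΓs, hζΓ⟩ := mem_membersThrough_iff.mp hΓ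
  have h1 : (1 : ℕ∞) ≤ idealOrder Γ ζ := (one_le_idealOrder_iff Γ ζ).mpr hζΓ
  have hfin : idealOrder Γ ζ ≠ ⊤ := idealOrder_ne_top_of_stalkIdeal_ne_bot (hnz Γ hΓs)
  obtain ⟨n, hn⟩ := ENat.ne_top_iff_exists.mp hfin
  rw [← hn] at h1 ⊢
  rw [ENat.toNat_coe]
  exact_mod_cast h1

/-- **`μ_ζ = 0` iff the component is carried ONCE with order ONE** (`compMults = [1]`), at a point of the configuration with non-zero stalks. [folklore] -/
theorem Boundary.compBadness_eq_zero_iff {ζ : D} [IsNoetherianRing (D.presheaf.stalk ζ)] (hnz : ∀ Γ ∈ Γs, stalkIdeal Γ ζ ≠ ⊥) (hζ : ζ ∈ Γs.divisorSet) :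
    Γs.compBadness ζ = 0 ↔ Γs.compMults ζ = [1] :=
  CureLaw.μ_eq_zero_iff _ (Boundary.one_le_of_mem_compMults hnz) (Boundary.compMults_ne_nil hζ)

/-- A component carried once with order one is not bad. [folklore] -/
theorem Boundary.not_two_le_sum_of_compMults_eq {ζ : D} (h : Γs.compMults ζ = [1]) : ¬ 2 ≤ (Γs.compMults ζ).sum := by
  rw [h]
  decide

/-- **`compMults ζ = [1]` iff exactly one member passes through `ζ`, with order `1` there.** [folklore] -/
theorem Boundary.compMults_eq_singleton_one_iff {ζ : D} :
    Γs.compMults ζ = [1] ↔ ∃ Γ, membersThrough Γs ζ = [Γ] ∧ idealOrder Γ ζ = 1 := by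
  unfold Boundary.compMults
  constructor
  · intro h
    rcases hm : membersThrough Γs ζ with _ | ⟨Γ, _ | ⟨Γ', t⟩⟩
    · rw [hm] at h
      simp at h
    · rw [hm] at h
      simp only [List.map_cons, List.map_nil, List.cons.injEq, and_true] at h
      exact ⟨Γ, rfl, (ENat.toNat_eq_iff one_ne_zero).mp h⟩
    · rw [hm] at h
      simp at h
  · rintro ⟨Γ, hΓ, h1⟩
    rw [hΓ, List.map_cons, List.map_nil, h1]
    rfl

/-- **A second member through `ζ` makes the list longer than `[1]`**: if `compMults ζ = [1]` then all members through `ζ` coincide. [folklore] -/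
theorem Boundary.eq_of_compMults_eq_singleton {ζ : D} (h : Γs.compMults ζ = [1]) {Γ Γ' : D.IdealSheafData} (hΓ : Γ ∈ Γs) (hΓ' : Γ' ∈ Γs)
    (hζ : ζ ∈ (Γ.support : Set D)) (hζ' : ζ ∈ (Γ'.support : Set D)) : Γ = Γ' := by
  obtain ⟨Γ₀, h0, -⟩ := Boundary.compMults_eq_singleton_one_iff.mp h
  have h1 : Γ ∈ membersThrough Γs ζ := mem_membersThrough_iff.mpr ⟨hΓ, hζ⟩
  have h2 : Γ' ∈ membersThrough Γs ζ := mem_membersThrough_iff.mpr ⟨hΓ', hζ'⟩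
  rw [h0, List.mem_singleton] at h1 h2
  rw [h1, h2]

/-- … and the member through `ζ` has order one there. [folklore] -/
theorem Boundary.idealOrder_eq_one_of_compMults_eq_singleton {ζ : D} (h : Γs.compMults ζ = [1]) {Γ : D.IdealSheafData} (hΓ : Γ ∈ Γs)
    (hζ : ζ ∈ (Γ.support : Set D)) : idealOrder Γ ζ = 1 := by
  obtain ⟨Γ₀, h0, h1⟩ := Boundary.compMults_eq_singleton_one_iff.mp h
  have h2 : Γ ∈ membersThrough Γs ζ := mem_membersThrough_iff.mpr ⟨hΓ, hζ⟩
  rw [h0, List.mem_singleton] at h2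
  rwa [h2]

/-- **THE ZERO LOCUS OF `M`** (finite index sets): `M = 0` iff every codimension-one component has `μ = 0` and no member has a counted crossing. [folklore] -/
theorem Boundary.badness_eq_zero_iff (hfinT : Γs.codimOnePoints.Finite) (hfinX : ∀ Γ ∈ Γs, (Γs.crossingPts Γ).Finite) :
    Γs.badness = 0 ↔ (∀ ζ ∈ Γs.codimOnePoints, Γs.compBadness ζ = 0) ∧ ∀ Γ ∈ Γs, Γs.crossingPts Γ = ∅ := by
  unfold Boundary.badness Boundary.crossingCount
  rw [Nat.add_eq_zero_iff, finsum_mem_eq_finite_toFinset_sum _ hfinT, Finset.sum_eq_zero_iff, Nat.mul_eq_zero, List.sum_eq_zero_iff]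
  simp only [Set.Finite.mem_toFinset, OfNat.ofNat_ne_zero, false_or, List.mem_map, forall_exists_index, and_imp, forall_apply_eq_imp_iff₂]
  refine and_congr Iff.rfl (forall₂_congr fun Γ hΓ => ?_)
  exact Set.ncard_eq_zero (hfinX Γ hΓ)

/-- **`M = 0` ⇒ no component is bad** (finite index sets, non-zero stalks). [folklore] -/
theorem Boundary.not_two_le_sum_of_badness_eq_zero [IsLocallyNoetherian D] (hfinT : Γs.codimOnePoints.Finite) (hfinX : ∀ Γ ∈ Γs, (Γs.crossingPts Γ).Finite)
    (hnz : ∀ Γ ∈ Γs, ∀ x : D, stalkIdeal Γ x ≠ ⊥) (hM : Γs.badness = 0) {ζ : D} (hζ : ζ ∈ Γs.codimOnePoints) : ¬ 2 ≤ (Γs.compMults ζ).sum := by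
  have h := ((Boundary.badness_eq_zero_iff hfinT hfinX).mp hM).1 ζ hζ
  rw [Boundary.compBadness_eq_zero_iff (fun Γ hΓ => hnz Γ hΓ ζ) hζ.1] at h
  exact Boundary.not_two_le_sum_of_compMults_eq h

/-- **`M = 0` ⇒ NO member has two codimension-one components through one point** (the crossing filter is idle since no component is bad). [folklore] -/
theorem Boundary.not_two_branches_of_badness_eq_zero [IsLocallyNoetherian D] (hfinT : Γs.codimOnePoints.Finite)
    (hfinX : ∀ Γ ∈ Γs, (Γs.crossingPts Γ).Finite) (hnz : ∀ Γ ∈ Γs, ∀ x : D, stalkIdeal Γ x ≠ ⊥) (hM : Γs.badness = 0) {Γ : D.IdealSheafData}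
    (hΓ : Γ ∈ Γs) {x ζ₁ ζ₂ : D} (h₁ : ζ₁ ∈ divisorialPoints Γ) (h₂ : ζ₂ ∈ divisorialPoints Γ) (hs₁ : ζ₁ ⤳ x) (hs₂ : ζ₂ ⤳ x) : ζ₁ = ζ₂ := by
  by_contra hne
  have hx : x ∈ Γs.crossingPts Γ :=
    ⟨⟨ζ₁, h₁, ζ₂, h₂, hne, hs₁, hs₂⟩, fun ζ hζ _ => Boundary.not_two_le_sum_of_badness_eq_zero hfinT hfinX hnz hM hζ⟩
  rw [((Boundary.badness_eq_zero_iff hfinT hfinX).mp hM).2 Γ hΓ] at hx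
  exact hx

/-- **`M = 0` ⇒ every codimension-one point of the configuration carries exactly one member, with order one.** [folklore] -/
theorem Boundary.compMults_eq_singleton_of_badness_eq_zero [IsLocallyNoetherian D] (hfinT : Γs.codimOnePoints.Finite)
    (hfinX : ∀ Γ ∈ Γs, (Γs.crossingPts Γ).Finite) (hnz : ∀ Γ ∈ Γs, ∀ x : D, stalkIdeal Γ x ≠ ⊥) (hM : Γs.badness = 0) {ζ : D}
    (hζ : ζ ∈ Γs.codimOnePoints) : Γs.compMults ζ = [1] := by
  have h := ((Boundary.badness_eq_zero_iff hfinT hfinX).mp hM).1 ζ hζ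
  rwa [Boundary.compBadness_eq_zero_iff (fun Γ hΓ => hnz Γ hΓ ζ) hζ.1] at h

end Defs

/-! ## The surface reading of record -/

section Surface

variable {W : Scheme.{u}}

/-- [OURS · L1 W4.2] **THE BADNESS COUNT OF RECORD `M(E, D)`** — the instance of o1's `SurfaceBadness` (RULING v3.14-43 (KN) (R-a)): the badness of the filtered
trace list `E.restrictOff ι_D` on the reduced surface `D̃ = (menuCentre D).subscheme`. With the ℓ-gate of res-L1-type-o1 18:12:54Z (`bad' := if ℓ = 0 then M
else 0`) it is the `bad` parameter of `SurfacePrep.ofRecord`. NOT a statement of the manuscript. [folklore] -/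
def badOfRecord : SurfaceBadness.{u} :=
  fun _ E D => (E.restrictOff (menuCentre D).subschemeι).badness

/-- Unfolding (`rfl`). [folklore] -/
theorem badOfRecord_eq (E : Boundary W) (D : Closeds W) : badOfRecord W E D = (E.restrictOff (menuCentre D).subschemeι).badness :=
  rfl

/-- [OURS · L1 W4.2] **THE ℓ-GATED BADNESS `bad'(E, D) := if ℓ(E, D) = 0 then M(E, D) else 0`** (res-L1-type-o1 18:12:54Z): with it o1's three-way case rule
`SurfacePrep.ofRecord regular phaseS bad' cure pointStepOfRecord` realises the order «point while `ℓ > 0`, cure at `ℓ = 0 ∧ M > 0`, READY at `ℓ = 0 ∧ M = 0`»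
(DESIGN CHECK 2 (c)). NOT a statement of the manuscript. [folklore] -/
def badGatedOfRecord : SurfaceBadness.{u} :=
  fun W E D => if surfaceSncLength E D = 0 then badOfRecord W E D else 0

/-- `bad' = 0` iff `ℓ > 0` or `M = 0`. [folklore] -/
theorem badGatedOfRecord_eq_zero_iff (E : Boundary W) (D : Closeds W) :
    badGatedOfRecord W E D = 0 ↔ 0 < surfaceSncLength E D ∨ badOfRecord W E D = 0 := by
  unfold badGatedOfRecord
  split_ifs with h
  · simp [h]
  · simp [Nat.pos_of_ne_zero h]

/-- `0 < bad'` iff `ℓ = 0` and `0 < M`. [folklore] -/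
theorem badGatedOfRecord_pos_iff (E : Boundary W) (D : Closeds W) :
    0 < badGatedOfRecord W E D ↔ surfaceSncLength E D = 0 ∧ 0 < badOfRecord W E D := by
  unfold badGatedOfRecord
  split_ifs with h
  · simp [h]
  · simp [h]

end Surface

end Summit.ResolutionOfSingularities.ResolutionOfSingularities.Theorems.SigmaMaxModificationsCorridor3.Sigma

end
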